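import Summits.ResolutionOfSingularities.ResolutionOfSingularities.Theorems.FrobeniusLadderFInjectiveMacaulayficationFullCentreDescent
import HarnessLib

/-!
# FULL-CENTRE DESCENT, TWO-PROPERTY FORM (invariant REGULAR / conclusion FULL) + THE PERSISTENCE LEMMA — generic kernel of «Lemma A» of the TT v2
# programme (crux `FInjectiveMacaulayfication` stmt-ResolutionOfSingularities-15315, chain w45a; res-L1-w45a-plan-1 RULING R19.4 (3)(b) «lead-1 g9: twin
# `FullCentreDescent.exists_fullCentre_of_tower_of_regularOff` … or, lead-1's choice, the P-parametric generalisation»; seat res-L1-w45a-lead-1 g9)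

[OURS · L1 W4.5a] Support file (`--supports stmt-ResolutionOfSingularities-15315 --as helper`); NOT a statement of any manuscript; def-free, fact-free, UNCONDITIONAL;
generic (no specimen, no recipe). Continues `…FullCentreDescent` (p631132) in the same namespace. AI-written (AI review is weaker than expert review).

WHY A TWIN. The desk's TT v2 (`L/w45a/TauTowerSig.lean` 1c471f18f0788d50, recipe-parametric; conjecture of record = the rad-τ recipe `tauCentre`) carries the invariant
«REGULAR off a proper closed `F`» down the tower, not «FULL off `F`»: a Sing-supported centre (`SingSupported c`: `supp (c p S) ⊆ closure (Reg S)ᶜ`) lies inside `F`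
only if `Sing S ⊆ F`, which «FULL off `F`» does not give (a FULL-but-non-F-regular singular point off `F` would lie in `supp tauCentre`). So p631132's
`exists_fullCentre_of_tower` (invariant FULL) does not serve rad τ; the statement below does, and is proved once for an arbitrary pair (invariant `R`, conclusion `Q`)
of stalk-local point properties descending along isomorphic stalk maps.
* §1 `exists_centre_of_tower (Q R) (hQ hR) (T c) (hc h0 hsucc)` — THE GENERIC LEMMA A (floor zero `exists_centre_of_forall`; transport `of_not_mem_preimage_of_isBlowup`;
  ONE descent step `exists_centre_of_isBlowup` = Temkin 2008 Lemma 2.1.4 `IsBlowup.exists_isBlowup_comp_supported` + `IsBlowup.unique` + `hQ`); instances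
  `fullCl_descends`, `mem_regularLocus_descends`, `support_subset_of_subset_closure_compl_regularLocus`; ★ **`exists_fullCentre_of_tower_of_regularOff p T c (hc : ∀ S,
  supp (c S) ⊆ closure (Reg S)ᶜ) h0 hsucc`** = TT v2's Lemma A for ANY Sing-supported recipe (`IntrinsicTower.….exists_fibreCentre_of_towerFull c hc p` is the instance
  `T := TowerFull c p`, `c := c p`, `hc := hc p`, `h0`/`hsucc := fun … h => h` — ONE term, validated against the desk signature verbatim); `exists_regularCentre_of_tower`
  = the same for a tower ending REGULAR (the «FULL ⇒ REGULAR» side of door v41, should a canonical-centre form of T″ be typed).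
* §2 `not_tower_of_persistent` / `not_exists_tower_of_persistent` — THE KERNEL SHAPE OF KILL CRITERION K-TT-a (R19.2 (6) / R19.4 (6)): a property `P` of floors forcing a
  non-`Q` point and persisting to SOME blowing up along the recipe's centre refutes every `T n` (`∃ n` form included) — where a periodicity certificate (R19.4 (4) (B1″))
  would be plugged in.
HONEST CAVEATS: nothing here says any tower terminates or loops; no recipe is evaluated; FULL is the crux's stalk clause, not F-rationality; the test-ideal recipe's
`SingSupported` is the desk's `singSupported_tauCentre`, not re-proved here.
[folklore assembly; cite: Temkin2008, Lemma 2.1.4] [cite: StacksProject, Tag 080B; Tag 02OS] [cite: GortzWedhorn2020, Def. 13.90, (13.19) p. 413]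
-/

-- single-problem summit: the doubled namespace component is forced
set_option linter.dupNamespace false

noncomputable section

open AlgebraicGeometry CategoryTheory CategoryTheory.Limits Literature.AlgebraicGeometry.Resolution TopologicalSpace IsLocalRing

namespace Summit.ResolutionOfSingularities.ResolutionOfSingularities.Theorems.FInjectiveMacaulayfication.FullCentreDescent

open Summit.ResolutionOfSingularities.ResolutionOfSingularities.Theorems.FInjectiveMacaulayfication
open SliceableCentre

/-! ## §1 The descent with TWO stalk-local point properties: an INVARIANT `R` off `F` and a CONCLUSION `Q` (regularity / FULL / …)

res-L1-w45a-plan-1 R19.4 (3)(b), lead-1's choice = the P-parametric generalisation: `FullCentreDescent.exists_fullCentre_of_tower` (p631132 §5) abstracted one step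
further — the invariant carried down the tower is a point property `R` («regular off `F`» in TT v2's Lemma A, «FULL off `F`» in §5) and the conclusion read off
floor zero is a point property `Q` (FULL); both DESCEND ALONG ISOMORPHIC STALK MAPS (`hR`, `hQ`; instances §6.4: FULL by `FTemkinClosedPoints.fullCl_of_isIso_stalkMap'`,
regularity by `IsRegularLocalRing.of_ringEquiv`). The centre recipe is asked to be supported inside every closed `F` off which the floor is `R` (`hc`) — for a
Sing-SUPPORTED recipe (`supp (c S) ⊆ closure Sing`, TT v2 `SingSupported`) and `R` := regularity this is `closure_minimal`. p631132 §5 is the case `R = Q = FULL`; TT v2's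
Lemma A is `R` := regular, `Q` := FULL (§1.5 `exists_fullCentre_of_tower_of_regularOff`); the «FULL ⇒ REGULAR» side (door v41's T″-stub) would be `R = Q` := regular
(§1.5 `exists_regularCentre_of_tower`). -/

/-- Floor zero for a stalk-local property `Q`: a non-empty scheme with `Q` at every point is `Q`-ified inside any `F` by `𝓚 = ⊤`. [folklore] -/
theorem exists_centre_of_forall (Q : (S : Scheme.{0}) → S → Prop)
    (hQ : ∀ {X Y : Scheme.{0}} (π : X ⟶ Y) (x : X) [IsIso (π.stalkMap x)], Q Y (π.base x) → Q X x)
    (S : Scheme.{0}) [Nonempty S] (F : Set S) (h : ∀ s : S, Q S s) :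
    ∃ 𝓚 : S.IdealSheafData, 𝓚 ≠ ⊥ ∧ (∀ s ∈ (𝓚.support : Set S), s ∈ F) ∧
      ∀ (S'' : Scheme.{0}) (π : S'' ⟶ S), IsBlowup π 𝓚 → ∀ s : S'', Q S'' s := by
  refine ⟨⊤, top_ne_bot_of_nonempty S, fun s hs => ?_, fun S'' π hπ s => ?_⟩
  · rw [Scheme.IdealSheafData.support_top] at hs
    simp at hs
  · haveI : IsIso π := hπ.isIso isEffectiveCartier_top
    exact hQ π s (h (π.base s))

/-- Transport of a stalk-local property `R` off `F` along a blowing up whose centre is supported in `F`. [folklore] [cite: StacksProject, Tag 02OS] -/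
theorem of_not_mem_preimage_of_isBlowup (R : (S : Scheme.{0}) → S → Prop)
    (hR : ∀ {X Y : Scheme.{0}} (π : X ⟶ Y) (x : X) [IsIso (π.stalkMap x)], R Y (π.base x) → R X x)
    {S₁ S : Scheme.{0}} {g : S₁ ⟶ S} {I : S.IdealSheafData} (hg : IsBlowup g I)
    (F : Set S) (hIF : (I.support : Set S) ⊆ F) (hF : ∀ s : S, s ∉ F → R S s)
    (s₁ : S₁) (hs₁ : g.base s₁ ∉ F) : R S₁ s₁ := by
  haveI := isIso_stalkMap_of_isBlowup_of_not_mem hg s₁ (fun h => hs₁ (hIF h))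
  exact hR g s₁ (hF _ hs₁)

/-- ONE DESCENT STEP for a stalk-local conclusion `Q` (Temkin 2008 Lemma 2.1.4 + uniqueness of blowing ups + `hQ`). [folklore assembly]
[cite: Temkin2008, Lemma 2.1.4] [cite: StacksProject, Tag 080B] -/
theorem exists_centre_of_isBlowup (Q : (S : Scheme.{0}) → S → Prop)
    (hQ : ∀ {X Y : Scheme.{0}} (π : X ⟶ Y) (x : X) [IsIso (π.stalkMap x)], Q Y (π.base x) → Q X x)
    {S₁ S : Scheme.{0}} [IsNoetherian S] [IsIntegral S₁] {g : S₁ ⟶ S} {I : S.IdealSheafData}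
    (hg : IsBlowup g I) (F : Set S) (hIF : (I.support : Set S) ⊆ F)
    (h₁ : ∃ 𝓚₁ : S₁.IdealSheafData, 𝓚₁ ≠ ⊥ ∧ (∀ s ∈ (𝓚₁.support : Set S₁), g.base s ∈ F) ∧
      ∀ (S'' : Scheme.{0}) (π : S'' ⟶ S₁), IsBlowup π 𝓚₁ → ∀ s : S'', Q S'' s) :
    ∃ 𝓚 : S.IdealSheafData, 𝓚 ≠ ⊥ ∧ (∀ s ∈ (𝓚.support : Set S), s ∈ F) ∧
      ∀ (S'' : Scheme.{0}) (π : S'' ⟶ S), IsBlowup π 𝓚 → ∀ s : S'', Q S'' s := by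
  obtain ⟨𝓚₁, h𝓚₁ne, h𝓚₁F, h𝓚₁Q⟩ := h₁
  obtain ⟨S₂, π₂, hπ₂⟩ := exists_isBlowup S₁ 𝓚₁
  haveI : IsIntegral S₂ := hπ₂.isIntegral h𝓚₁ne
  obtain ⟨𝓚, h𝓚, h𝓚F⟩ := hg.exists_isBlowup_comp_supported g I π₂ 𝓚₁ F hIF hπ₂ (fun s hs => h𝓚₁F s hs)
  refine ⟨𝓚, RegularBlowupModelDim2.ne_bot_of_isBlowup h𝓚, fun s hs => h𝓚F hs, fun S'' π hπ s => ?_⟩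
  obtain ⟨e, -, -⟩ := hπ.unique h𝓚
  exact hQ e.hom s (h𝓚₁Q S₂ π₂ hπ₂ (e.hom.base s))

/-- **GENERIC LEMMA A WITH AN INVARIANT `R` AND A CONCLUSION `Q`.** Tower predicate `T` (`T 0 S ⇒ Q` at every point; `T (n+1) S ⇒ T n` on every blowing up
along `c S`), centre recipe `c` supported inside every closed `F` off which the floor is `R` (`hc`), `R` and `Q` descending along isomorphic stalk maps. Then
`T n S` on a Noetherian integral `S` that is `R` off a closed `F` missing a point gives ONE centre `𝓚 ≠ ⊥`, `supp 𝓚 ⊆ F`, all of whose blowing ups are `Q` at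
every point. Induction on `n` generalizing the floor (floor zero; blow up `c S`, `≠ ⊥` by `hc` and the missing point; transport `R`; induction hypothesis inside
`g⁻¹F`; descend). [folklore assembly; OURS] [cite: Temkin2008, Lemma 2.1.4] [cite: StacksProject, Tag 080B; Tag 02OS] -/
theorem exists_centre_of_tower (Q R : (S : Scheme.{0}) → S → Prop)
    (hQ : ∀ {X Y : Scheme.{0}} (π : X ⟶ Y) (x : X) [IsIso (π.stalkMap x)], Q Y (π.base x) → Q X x)
    (hR : ∀ {X Y : Scheme.{0}} (π : X ⟶ Y) (x : X) [IsIso (π.stalkMap x)], R Y (π.base x) → R X x)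
    (T : ℕ → Scheme.{0} → Prop) (c : (S : Scheme.{0}) → S.IdealSheafData)
    (hc : ∀ (S : Scheme.{0}) [IsNoetherian S] [IsIntegral S] (F : Set S), IsClosed F →
      (∀ s : S, s ∉ F → R S s) → ((c S).support : Set S) ⊆ F)
    (h0 : ∀ (S : Scheme.{0}), T 0 S → ∀ s : S, Q S s)
    (hsucc : ∀ (n : ℕ) (S : Scheme.{0}), T (n + 1) S → ∀ (S₁ : Scheme.{0}) (g : S₁ ⟶ S), IsBlowup g (c S) → T n S₁) :
    ∀ (n : ℕ) (S : Scheme.{0}) [IsNoetherian S] [IsIntegral S] (F : Set S), IsClosed F → (∃ s : S, s ∉ F) →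
      (∀ s : S, s ∉ F → R S s) → T n S →
      ∃ 𝓚 : S.IdealSheafData, 𝓚 ≠ ⊥ ∧ (∀ s ∈ (𝓚.support : Set S), s ∈ F) ∧
        ∀ (S'' : Scheme.{0}) (π : S'' ⟶ S), IsBlowup π 𝓚 → ∀ s : S'', Q S'' s := by
  intro n
  induction n with
  | zero =>
    intro S _ _ F _ hne _ hT
    obtain ⟨s, -⟩ := hne
    haveI : Nonempty S := ⟨s⟩
    exact exists_centre_of_forall Q hQ S F (h0 S hT)
  | succ n ih =>
    intro S _ _ F hF hne hRF hT
    have hcF : ((c S).support : Set S) ⊆ F := hc S F hF hRF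
    have hcne : c S ≠ ⊥ := by
      intro h
      obtain ⟨s, hs⟩ := hne
      have h1 : (c S).support = ⊤ := Scheme.IdealSheafData.support_eq_top_iff.mpr h
      have h2 : s ∈ ((c S).support : Set S) := by
        rw [h1]
        exact Set.mem_univ s
      exact hs (hcF h2)
    obtain ⟨S₁, g, hg⟩ := exists_isBlowup S (c S)
    haveI : IsIntegral S₁ := hg.isIntegral hcne
    haveI : IsNoetherian S₁ := isNoetherian_of_isBlowup hg
    obtain h₁ := ih S₁ (g.base ⁻¹' F) (hF.preimage g.continuous) (exists_not_mem_preimage_of_isBlowup hg F hcF hne)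
      (fun s₁ hs₁ => of_not_mem_preimage_of_isBlowup R hR hg F hcF hRF s₁ hs₁) (hsucc n S hT S₁ g hg)
    exact exists_centre_of_isBlowup Q hQ hg F hcF h₁

/-- `hQ`/`hR` for FULL: FULL descends along isomorphic stalk maps (p631132 §5 = §1 here at `R = Q := FULL`). [folklore] -/
theorem fullCl_descends (p : ℕ) {X Y : Scheme.{0}} (π : X ⟶ Y) (x : X) [IsIso (π.stalkMap x)]
    (h : FullCl p (Y.presheaf.stalk (π.base x))) : FullCl p (X.presheaf.stalk x) :=
  FTemkinClosedPoints.fullCl_of_isIso_stalkMap' p π x h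

/-- `hQ`/`hR` for REGULARITY: membership in the regular locus descends along isomorphic stalk maps. [folklore] -/
theorem mem_regularLocus_descends {X Y : Scheme.{0}} (π : X ⟶ Y) (x : X) [IsIso (π.stalkMap x)]
    (h : π.base x ∈ Scheme.regularLocus Y) : x ∈ Scheme.regularLocus X := by
  change IsRegularLocalRing (Y.presheaf.stalk (π.base x)) at h
  change IsRegularLocalRing (X.presheaf.stalk x)
  exact IsRegularLocalRing.of_ringEquiv (asIso (π.stalkMap x)).commRingCatIsoToRingEquiv

/-- A recipe supported in the closure of the singular locus is supported inside every CLOSED `F` off which the floor is regular. [folklore] -/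
theorem support_subset_of_subset_closure_compl_regularLocus {S : Scheme.{0}} (J : S.IdealSheafData)
    (hJ : (J.support : Set S) ⊆ closure ((Scheme.regularLocus S)ᶜ)) (F : Set S) (hF : IsClosed F)
    (hreg : ∀ s : S, s ∉ F → s ∈ Scheme.regularLocus S) : (J.support : Set S) ⊆ F :=
  hJ.trans (closure_minimal (fun s hs => by_contra fun h => hs (hreg s h)) hF)

/-- **LEMMA A OF TT v2 IN GENERIC FORM (invariant REGULAR, conclusion FULL).** For a centre recipe supported, on every floor, in the closure of the singular
locus (TT v2 `SingSupported`, here as the hypothesis `hc`), and a tower predicate reading FULL off floor zero: a tower of height `n` from a Noetherian integral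
`S` REGULAR off a closed `F` missing a point contracts to ONE centre `𝓚 ≠ ⊥`, `supp 𝓚 ⊆ F`, all of whose blowing ups are FULL at every point. TT v2's
`IntrinsicTower.exists_fibreCentre_of_towerFull c hc p` is the instance `T := TowerFull c p`, `c := c p`, `hc := hc p`. [folklore assembly; OURS]
[cite: Temkin2008, Lemma 2.1.4] [cite: StacksProject, Tag 080B; Tag 02OS] -/
theorem exists_fullCentre_of_tower_of_regularOff (p : ℕ) (T : ℕ → Scheme.{0} → Prop) (c : (S : Scheme.{0}) → S.IdealSheafData)
    (hc : ∀ S : Scheme.{0}, ((c S).support : Set S) ⊆ closure ((Scheme.regularLocus S)ᶜ))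
    (h0 : ∀ (S : Scheme.{0}), T 0 S → ∀ s : S, FullCl p (S.presheaf.stalk s))
    (hsucc : ∀ (n : ℕ) (S : Scheme.{0}), T (n + 1) S → ∀ (S₁ : Scheme.{0}) (g : S₁ ⟶ S), IsBlowup g (c S) → T n S₁) :
    ∀ (n : ℕ) (S : Scheme.{0}) [IsNoetherian S] [IsIntegral S] (F : Set S), IsClosed F → (∃ s : S, s ∉ F) →
      (∀ s : S, s ∉ F → s ∈ Scheme.regularLocus S) → T n S →
      ∃ 𝓚 : S.IdealSheafData, 𝓚 ≠ ⊥ ∧ (∀ s ∈ (𝓚.support : Set S), s ∈ F) ∧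
        ∀ (S'' : Scheme.{0}) (π : S'' ⟶ S), IsBlowup π 𝓚 → ∀ s : S'', FullCl p (S''.presheaf.stalk s) :=
  exists_centre_of_tower (fun S s => FullCl p (S.presheaf.stalk s)) (fun S s => s ∈ Scheme.regularLocus S)
    (fun π x _ h => fullCl_descends p π x h) (fun π x _ h => mem_regularLocus_descends π x h) T c
    (fun S _ _ F hF hreg => support_subset_of_subset_closure_compl_regularLocus (c S) (hc S) F hF hreg) h0 hsucc

/-- **LEMMA A FOR REGULARITY** (the «FULL ⇒ REGULAR» side, same recipe hypothesis): a Sing-supported tower ending REGULAR everywhere contracts to ONE centre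
`𝓚 ≠ ⊥`, `supp 𝓚 ⊆ F`, all of whose blowing ups are regular at every point. [folklore assembly; OURS] [cite: Temkin2008, Lemma 2.1.4] [cite: StacksProject, Tag 080B] -/
theorem exists_regularCentre_of_tower (T : ℕ → Scheme.{0} → Prop) (c : (S : Scheme.{0}) → S.IdealSheafData)
    (hc : ∀ S : Scheme.{0}, ((c S).support : Set S) ⊆ closure ((Scheme.regularLocus S)ᶜ))
    (h0 : ∀ (S : Scheme.{0}), T 0 S → ∀ s : S, s ∈ Scheme.regularLocus S)
    (hsucc : ∀ (n : ℕ) (S : Scheme.{0}), T (n + 1) S → ∀ (S₁ : Scheme.{0}) (g : S₁ ⟶ S), IsBlowup g (c S) → T n S₁) :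
    ∀ (n : ℕ) (S : Scheme.{0}) [IsNoetherian S] [IsIntegral S] (F : Set S), IsClosed F → (∃ s : S, s ∉ F) →
      (∀ s : S, s ∉ F → s ∈ Scheme.regularLocus S) → T n S →
      ∃ 𝓚 : S.IdealSheafData, 𝓚 ≠ ⊥ ∧ (∀ s ∈ (𝓚.support : Set S), s ∈ F) ∧
        ∀ (S'' : Scheme.{0}) (π : S'' ⟶ S), IsBlowup π 𝓚 → ∀ s : S'', s ∈ Scheme.regularLocus S'' :=
  exists_centre_of_tower (fun S s => s ∈ Scheme.regularLocus S) (fun S s => s ∈ Scheme.regularLocus S)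
    (fun π x _ h => mem_regularLocus_descends π x h) (fun π x _ h => mem_regularLocus_descends π x h) T c
    (fun S _ _ F hF hreg => support_subset_of_subset_closure_compl_regularLocus (c S) (hc S) F hF hreg) h0 hsucc

/-! ## §2 Persistence kills a tower — the kernel shape of kill criterion K-TT-a (R19.2 (6))

If some property `P` of schemes forces a non-`Q` point (`hP`) and PERSISTS to at least one blowing up along the recipe's centre (`hstep` —
an `∃`, so ONE computed chart of ONE blowing up per floor suffices), then no floor satisfying `P` has a tower of ANY height ending `Q`
everywhere. With `T := IntrinsicTower.TowerFull c p`, `c := c p` (TT v2), `Q := FULL`: a LOOP (a local normal form recurring under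
the recipe with a non-FULL point) at ONE admissible floor `S′` gives `∀ n, ¬ TowerFull c p n S′`, i.e. `¬ TowerTerminates c`. -/

/-- **PERSISTENCE LEMMA.** `T 0 ⇒ Q everywhere`, `T (n+1) S ⇒ T n` on every blowing up along `c S`; `P ⇒ some non-Q point`; `P S ⇒ P S₁` for SOME
blowing up `S₁ ⟶ S` along `c S`. Then `P S ⇒ ∀ n, ¬ T n S`. Induction on `n` generalizing `S`. [folklore; OURS] -/
theorem not_tower_of_persistent (Q : (S : Scheme.{0}) → S → Prop) (T : ℕ → Scheme.{0} → Prop)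
    (c : (S : Scheme.{0}) → S.IdealSheafData)
    (h0 : ∀ (S : Scheme.{0}), T 0 S → ∀ s : S, Q S s)
    (hsucc : ∀ (n : ℕ) (S : Scheme.{0}), T (n + 1) S → ∀ (S₁ : Scheme.{0}) (g : S₁ ⟶ S), IsBlowup g (c S) → T n S₁)
    (P : Scheme.{0} → Prop) (hP : ∀ S : Scheme.{0}, P S → ∃ s : S, ¬ Q S s)
    (hstep : ∀ S : Scheme.{0}, P S → ∃ (S₁ : Scheme.{0}) (g : S₁ ⟶ S), IsBlowup g (c S) ∧ P S₁) :
    ∀ (n : ℕ) (S : Scheme.{0}), P S → ¬ T n S := by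
  intro n
  induction n with
  | zero =>
    intro S hS hT
    obtain ⟨s, hs⟩ := hP S hS
    exact hs (h0 S hT s)
  | succ n ih =>
    intro S hS hT
    obtain ⟨S₁, g, hg, hS₁⟩ := hstep S hS
    exact ih S₁ hS₁ (hsucc n S hT S₁ g hg)

/-- The `∃ n` form: a persistent `P` at a floor refutes «some tower from this floor ends `Q` everywhere». [folklore; OURS] -/
theorem not_exists_tower_of_persistent (Q : (S : Scheme.{0}) → S → Prop) (T : ℕ → Scheme.{0} → Prop)
    (c : (S : Scheme.{0}) → S.IdealSheafData)
    (h0 : ∀ (S : Scheme.{0}), T 0 S → ∀ s : S, Q S s)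
    (hsucc : ∀ (n : ℕ) (S : Scheme.{0}), T (n + 1) S → ∀ (S₁ : Scheme.{0}) (g : S₁ ⟶ S), IsBlowup g (c S) → T n S₁)
    (P : Scheme.{0} → Prop) (hP : ∀ S : Scheme.{0}, P S → ∃ s : S, ¬ Q S s)
    (hstep : ∀ S : Scheme.{0}, P S → ∃ (S₁ : Scheme.{0}) (g : S₁ ⟶ S), IsBlowup g (c S) ∧ P S₁)
    (S : Scheme.{0}) (hS : P S) : ¬ ∃ n : ℕ, T n S :=
  fun ⟨n, hT⟩ => not_tower_of_persistent Q T c h0 hsucc P hP hstep n S hS hT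

end Summit.ResolutionOfSingularities.ResolutionOfSingularities.Theorems.FInjectiveMacaulayfication.FullCentreDescent

end
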